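import Literature.Probability.RandomPlanarGeometry.HammersleyWelshExplicitZ2
import Literature.Probability.RandomPlanarGeometry.HammersleyWelshNumeralZ2
import Mathlib.Analysis.Complex.ExponentialBounds
import HarnessLib

/-!
# All-`n` Hammersley–Welsh on `ℤ²` with the halved constant: `c_n(ℤ²) ≤ 4·10¹¹ · e^{1.82 √n} · μⁿ`

Topic `Literature/Probability/RandomPlanarGeometry` (continues `HammersleyWelshExplicitZ2.lean`:
`Zd.count_le_exp_sharp_two`, `∀ N ≥ 791, c_N ≤ exp(π√(N/3) + π²/6 + 1)·μ^{N+1}` through the lane's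
computational sub-ballisticity certificate; and `HammersleyWelshNumeralZ2.lean`: `Zd.count_two_le_numeral`,
`∀ n ≥ 1, c_n ≤ 250·exp(2.57√n)·μⁿ`, standard axioms).

Source shape: N. Madras, G. Slade, *The Self-Avoiding Walk* (1993), Theorem 3.1.1 (`c_N ≤ μ^N e^{B√N}`,
`B > π(2/3)^{1/2}`, `N ≥ N₀(B)`); T. Hutchcroft, Electron. Commun. Probab. 23 (2018), Theorem 1.4 (the
window form behind the halved constant `π(1/3)^{1/2}`).

* **`count_two_le_numeral_sharp` — for every `n ≥ 1`, `c_n(ℤ²) ≤ 4·10¹¹ · exp((182/100)·√n) · μ(ℤ²)ⁿ`.**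
  For `n ≥ 791` this is `count_le_exp_sharp_two` (`π(1/3)^{1/2} = 1.8138 ≤ 1.82`, `e^{π²/6+1}·μ ≤ 21·3`);
  for `n ≤ 790` it is `count_two_le_numeral` with `250·e^{(2.57−1.82)√n} ≤ 250·e^{0.75·28.11} ≤ 4·10¹¹`.
  `A = 4·10¹¹ = e^{26.7}` is the price of the `n ≤ 790` crossover: for `n ≤ 790` the boundary bound of
  `HammersleyWelshNumeralZ2.lean` (`250·e^{2.57√n}`, and `exp(π√(2n/3) + π²/3 + 1)·μ^{n+1}`) is numerically far
  better; the present pair only wins for `n ≳ 800`. REPORT footnote to the numeral row, not a row.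

Lineage: COMPUTATIONAL (inherits the `native_decide` certificate behind `count_le_exp_sharp_two`); the
`(250, 2.57)` bound is standard-axiom. Lane «pcv-sawmu», item «Z2-HW-NUMERAL-SHARP».
-/

noncomputable section

open Finset
open Literature.Probability.RandomPlanarGeometry.SAW

namespace Literature.Probability.RandomPlanarGeometry.SAW.Zd

/-- `π √(N/3) ≤ (182/100) √N` (`π(1/3)^{1/2} = 1.8138`). [folklore] -/
private theorem pi_sqrt_third_le (N : ℕ) : Real.pi * Real.sqrt (N / 3) ≤ 182 / 100 * Real.sqrt N := by
  have hπ : Real.pi < 3.1416 := Real.pi_lt_d4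
  have hπ0 : 0 < Real.pi := Real.pi_pos
  have h13 : Real.sqrt (1 / 3 : ℝ) ≤ 0.5774 := by
    rw [Real.sqrt_le_left (by norm_num)]; norm_num
  have h130 : 0 ≤ Real.sqrt (1 / 3 : ℝ) := Real.sqrt_nonneg _
  have e : Real.sqrt (N / 3) = Real.sqrt (1 / 3) * Real.sqrt N := by
    rw [← Real.sqrt_mul (by norm_num)]; congr 1; ring
  rw [e, ← mul_assoc]
  exact mul_le_mul_of_nonneg_right (by nlinarith) (Real.sqrt_nonneg _)

/-- `exp(π²/6 + 1) ≤ 21` (`π²/6 + 1 ≤ 3`, `e³ ≤ 20.1`). [folklore] -/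
private theorem exp_pi_sq_div_six_add_one_le : Real.exp (Real.pi ^ 2 / 6 + 1) ≤ 21 := by
  have hπ : Real.pi < 3.1416 := Real.pi_lt_d4
  have hπ0 : 0 < Real.pi := Real.pi_pos
  have h3 : Real.pi ^ 2 / 6 + 1 ≤ 3 := by nlinarith
  have he1 : Real.exp 1 < 2.7182818286 := Real.exp_one_lt_d9
  have he0 : 0 < Real.exp 1 := Real.exp_pos 1
  calc Real.exp (Real.pi ^ 2 / 6 + 1) ≤ Real.exp 3 := Real.exp_le_exp.2 h3
    _ = Real.exp 1 ^ 3 := by rw [show (3 : ℝ) = (3 : ℕ) * 1 by norm_num, Real.exp_nat_mul]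
    _ ≤ 2.7182818286 ^ 3 := pow_le_pow_left₀ he0.le he1.le 3
    _ ≤ 21 := by norm_num

/-- `250 · exp((3/4)√n) ≤ 4·10¹¹` for `n ≤ 790` (`√790 ≤ 28.11`, `e^{21.0825} ≤ 1.6·10⁹`). [folklore] -/
private theorem small_range_const (n : ℕ) (hn : n ≤ 790) :
    250 * Real.exp (3 / 4 * Real.sqrt n) ≤ 4 * 10 ^ 11 := by
  have hsq : Real.sqrt n ≤ 28.11 := by
    rw [Real.sqrt_le_left (by norm_num)]
    have : (n : ℝ) ≤ 790 := by exact_mod_cast hn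
    linarith
  have he1 : Real.exp 1 < 2.7182818286 := Real.exp_one_lt_d9
  have he0 : 0 < Real.exp 1 := Real.exp_pos 1
  have h21 : Real.exp 21 ≤ 2.7182818286 ^ 21 := by
    rw [show (21 : ℝ) = (21 : ℕ) * 1 by norm_num, Real.exp_nat_mul]
    exact pow_le_pow_left₀ he0.le he1.le 21
  have h009 : Real.exp (9 / 100 : ℝ) ≤ 100 / 91 := by
    have h := Real.add_one_le_exp (-(9 / 100 : ℝ))
    have hpos : 0 < Real.exp (-(9 / 100 : ℝ)) := Real.exp_pos _
    have hinv : Real.exp (9 / 100 : ℝ) = (Real.exp (-(9 / 100 : ℝ)))⁻¹ := by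
      rw [Real.exp_neg, inv_inv]
    rw [hinv, inv_le_comm₀ hpos (by norm_num)]
    linarith
  have hexp : Real.exp (3 / 4 * Real.sqrt n) ≤ Real.exp 21 * Real.exp (9 / 100) := by
    rw [← Real.exp_add]; exact Real.exp_le_exp.2 (by linarith)
  calc 250 * Real.exp (3 / 4 * Real.sqrt n) ≤ 250 * (2.7182818286 ^ 21 * (100 / 91)) := by
        refine mul_le_mul_of_nonneg_left (hexp.trans ?_) (by norm_num)
        exact mul_le_mul h21 h009 (Real.exp_pos _).le (by positivity)
    _ ≤ 4 * 10 ^ 11 := by norm_num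

/-- **All-`n` Hammersley–Welsh on `ℤ²` with the halved exponent constant:
`c_n(ℤ²) ≤ 4·10¹¹ · exp((182/100)·√n) · μ(ℤ²)ⁿ` for every `n ≥ 1`** (`n ≥ 791`: the certificate theorem
`count_le_exp_sharp_two`; `n ≤ 790`: the standard-axiom `count_two_le_numeral` and
`250·e^{0.75√n} ≤ 4·10¹¹`). Computational lineage. [cite: MadrasSlade1993, Theorem 3.1.1]
[cite: Hutchcroft2018HammersleyWelsh, Theorem 1.4] -/
theorem count_two_le_numeral_sharp (n : ℕ) (hn : 1 ≤ n) :
    (count 2 n : ℝ) ≤ 4 * 10 ^ 11 * Real.exp (182 / 100 * Real.sqrt n) * connectiveConstant 2 ^ n := by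
  have hμ2 : (2 : ℝ) ≤ connectiveConstant 2 := by exact_mod_cast natCast_le_connectiveConstant 2
  have hμ3 : connectiveConstant 2 ≤ 3 := by
    have := (BDGS2012_connectiveConstant_bounds_holds 2 (by norm_num)).2
    norm_num at this; linarith
  have hμ0 : 0 ≤ connectiveConstant 2 := by linarith
  have hμn : 0 ≤ connectiveConstant 2 ^ n := pow_nonneg hμ0 n
  have hE0 : 0 < Real.exp (182 / 100 * Real.sqrt n) := Real.exp_pos _
  rcases Nat.lt_or_ge n 791 with hsmall | hbig
  · -- `n ≤ 790`
    have h := count_two_le_numeral n hn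
    have hsplit : Real.exp (257 / 100 * Real.sqrt n) =
        Real.exp (182 / 100 * Real.sqrt n) * Real.exp (3 / 4 * Real.sqrt n) := by
      rw [← Real.exp_add]; congr 1; ring
    have hc := small_range_const n (by omega)
    calc (count 2 n : ℝ) ≤ 250 * Real.exp (257 / 100 * Real.sqrt n) * connectiveConstant 2 ^ n := h
      _ = (250 * Real.exp (3 / 4 * Real.sqrt n)) * Real.exp (182 / 100 * Real.sqrt n) *
          connectiveConstant 2 ^ n := by rw [hsplit]; ring
      _ ≤ 4 * 10 ^ 11 * Real.exp (182 / 100 * Real.sqrt n) * connectiveConstant 2 ^ n :=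
          mul_le_mul_of_nonneg_right (mul_le_mul_of_nonneg_right hc hE0.le) hμn
  · -- `n ≥ 791`: the certificate theorem
    have h := count_le_exp_sharp_two n hbig
    have hK := pi_sqrt_third_le n
    have hA := exp_pi_sq_div_six_add_one_le
    have hexp : Real.exp (Real.pi * Real.sqrt (n / 3) + Real.pi ^ 2 / 6 + 1) ≤
        Real.exp (182 / 100 * Real.sqrt n) * 21 := by
      rw [show Real.pi * Real.sqrt (n / 3) + Real.pi ^ 2 / 6 + 1 =
        Real.pi * Real.sqrt (n / 3) + (Real.pi ^ 2 / 6 + 1) by ring, Real.exp_add]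
      exact mul_le_mul (Real.exp_le_exp.2 hK) hA (Real.exp_pos _).le (Real.exp_pos _).le
    calc (count 2 n : ℝ) ≤ Real.exp (Real.pi * Real.sqrt (n / 3) + Real.pi ^ 2 / 6 + 1) *
          connectiveConstant 2 ^ (n + 1) := h
      _ ≤ (Real.exp (182 / 100 * Real.sqrt n) * 21) * (connectiveConstant 2 ^ n * 3) := by
          rw [pow_succ]
          exact mul_le_mul hexp (mul_le_mul_of_nonneg_left hμ3 hμn) (by positivity) (by positivity)
      _ ≤ 4 * 10 ^ 11 * Real.exp (182 / 100 * Real.sqrt n) * connectiveConstant 2 ^ n := by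
          nlinarith [hE0, hμn, mul_nonneg hE0.le hμn]

end Literature.Probability.RandomPlanarGeometry.SAW.Zd

end
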